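import Literature.Geometry.Symplectic.LegendrianStabilisation
import Literature.Geometry.Symplectic.LegendrianRealisation
import HarnessLib

/-!
# Adding left twists to a Legendrian knot: the twisting computation and the discharge of `Gompf1998_addLeftTwists`

Topic `Literature/Geometry/Symplectic`; the proofs file below `LegendrianRealisation.lean`
discharging the named fact `Gompf1998_addLeftTwists` (Gompf, *Handlebody construction of Stein
surfaces*, Ann. of Math. 148 (1998), §1, p. 622: *"we can add any number of left (negative)
twists to a Legendrian link in a `C⁰`-small manner … simply add a spiral"*) as
`Gompf1998_addLeftTwists_holds`, on top of the bricks `LegendrianStabilisationModel`,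
`LegendrianStabilisationFraming`, `LegendrianDarbouxBox`, `BoundaryChartImmersion`,
`LegendrianDarbouxChart`, `LegendrianStabilisation`.  Everything is proved.

## Part 1. The stabilisation adds one twist (`StabData.twisting_knot_one`)

`twisting (X.knot 1) (X.νfam ν 1) = twisting X.K (X.νfam ν (1/2)) + 1`.  The two twisting loops
agree off the core `|t̂| < 4ε` of the window; on the core they are read in the box frame
(`kahlerForm_bv`, `contactForm_bv`): `ℓ♯ = (g p + ∂₀g q) + i g q` for `(K, ν♯)` and
`ℓ' = (g̃ x' p + ∂_d g̃ q) + i g̃ q` for `(K₁, ν')`, `(0, p, q) = fr (t̂/ε)` the model framing.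
After shifting the parameter (`wind_comp_add_of_periodic`) the ratio loop is deformed by removing
the shear terms (`wind_eq_of_homotopy`) to `(g̃/g) · v₁/v₀`, whose explicit logarithm built from
the model logarithms `l₁`, `l₀` (`LegendrianStabilisationFraming.lean`) changes by `2πi` across
the window (`Λ_one_sub_Λ_zero`); additivity of `wind` concludes.

## Part 2. Assembly

* `StabData.isSmall_isotopy₂`; `LegendrianArc.exists_stabData` — **existence of stabilisation
  data** for a Legendrian knot, a base parameter and an open `𝒪 ⊇ graph K`: the scale `ε` is
  chosen last, small against the window, the box, an open neighbourhood of the base point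
  avoiding the far arc of the knot (compactness, injectivity) and a product neighbourhood inside
  `𝒪` (separation property and `𝒪`-smallness of the transported model curves).
* `StabData.framingHomotopic_νfam_half`, `StabData.twisting_νfam_half` — the first half of the
  framing family is a homotopy of framings of the fixed knot, so the twisting number is unchanged
  (TH, `twisting_eq_of_framingHomotopic_holds`).
* `KnotIsotopyInBoundary.trans'`, `IsFramingAlong.trans'`, `KnotIsotopyInBoundary.IsSmall.trans'`
  — concatenation of isotopies of knots in `∂W`, of framing families, of smallness (halves
  reparametrised by smooth step functions constant near the junction).
* `exists_addLeftTwist_one`, `exists_addLeftTwists` (induction on `n`),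
  `Gompf1998_addLeftTwists_holds`.

## References

* R. E. Gompf, *Handlebody construction of Stein surfaces*, Ann. of Math. 148 (1998), §1. [Gompf1998]
-/

noncomputable section

open scoped Manifold ContDiff Topology
open Set Function Metric
open Literature.Geometry.Kaehler Literature.Topology.FourManifolds

namespace Literature.Geometry.Symplectic

/-- `ℝ⁴`, the model of the tangent spaces. -/
local notation "E4" => EuclideanSpace ℝ (Fin 4)
/-- `ℝ³`. -/
local notation "E3" => EuclideanSpace ℝ (Fin 3)
/-- The unit sphere `𝕊ⁿ`. -/
local notation "𝕊 " n:arg => (Metric.sphere (0 : EuclideanSpace ℝ (Fin (n + 1))) 1)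

namespace LegendrianDarboux

variable {W : Type*} [TopologicalSpace W] [ChartedSpace (EuclideanHalfSpace 4) W]
  [IsManifold (𝓡∂ 4) ∞ W] [CompactSpace W]

variable [T2Space W]

namespace StabData

variable {S : SteinStructure W} (X : StabData S)

/-! ### Twisting: the loops of the two framings -/

section TwistingLoops

open Literature.Topology.PlaneTopology

omit [T2Space W] in
/-- **Shift invariance of the winding number of a `1`-periodic loop in `ℂ ∖ {0}`.** [folklore] -/
theorem _root_.Literature.Geometry.Symplectic.wind_comp_add_of_periodic {f : ℝ → ℂ} (hf : Continuous f)
    (hne : ∀ t, f t ≠ 0) (hper : ∀ t, f (t + 1) = f t) (a : ℝ) :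
    wind (fun t => f (t + a)) = wind f := by
  set lo : ℝ := -(|a| + 1) with hlo
  set hi : ℝ := |a| + 2 with hhi
  obtain ⟨L, hL, hLe⟩ := hasLogOn_Icc (a := lo) (b := hi) hf.continuousOn fun t _ => hne t
  have ha1 : -|a| ≤ a := neg_abs_le a
  have ha2 : a ≤ |a| := le_abs_self a
  have ha0 : 0 ≤ |a| := abs_nonneg a
  have hsub1 : Icc (0 : ℝ) 1 ⊆ Icc lo hi := Icc_subset_Icc (by rw [hlo]; linarith) (by rw [hhi]; linarith)
  have e1 := wind_spec (f := f) (l := L) (hL.mono hsub1) (fun t ht => hLe t (hsub1 ht))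
    (by rw [← hper 0, zero_add])
  have hmem : ∀ t ∈ Icc (0 : ℝ) 1, t + a ∈ Icc lo hi := fun t ht =>
    ⟨by rw [hlo]; linarith [ht.1], by rw [hhi]; linarith [ht.2]⟩
  have hLa : ContinuousOn (fun t => L (t + a)) (Icc 0 1) :=
    hL.comp (continuous_id.add continuous_const : Continuous fun t : ℝ => t + a).continuousOn hmem
  have e2 := wind_spec (f := fun t => f (t + a)) (l := fun t => L (t + a)) hLa
    (fun t ht => hLe (t + a) (hmem t ht))
    (by show f (0 + a) = f (1 + a); rw [zero_add, add_comm, hper])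
  have hsub2 : ∀ x ∈ Icc lo (hi - 1), x + 1 ∈ Icc lo hi := fun x hx =>
    ⟨by linarith [hx.1], by linarith [hx.2]⟩
  have hsub3 : Icc lo (hi - 1) ⊆ Icc lo hi := Icc_subset_Icc le_rfl (by linarith)
  obtain ⟨m, hm⟩ := exists_int_eq_add_of_exp_eq (l := fun x => L (x + 1)) (m := L) isPreconnected_Icc
    (hL.comp (continuous_id.add continuous_const : Continuous fun t : ℝ => t + 1).continuousOn hsub2) (hL.mono hsub3)
    (fun x hx => by rw [hLe _ (hsub2 x hx), hLe _ (hsub3 hx), hper])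
  have h0 := hm 0 ⟨by rw [hlo]; linarith, by rw [hhi]; linarith⟩
  have ha := hm a ⟨by rw [hlo]; linarith, by rw [hhi]; linarith⟩
  apply int_eq_of_mul_two_pi_I_eq
  rw [← e2, ← e1]
  simp only [zero_add] at h0 ⊢
  rw [add_comm (1 : ℝ) a, ha, h0]
  ring

variable {ν : 𝕊 1 → E4}

/-- The box coordinates at time `1/2`. [folklore] -/
theorem mf_half (t : ℝ) : X.mf ν (1 / 2) t = X.n₃ ν 1 t := X.mf_of_half_le le_rfl t

/-- The box coordinates at time `1`. [folklore] -/
theorem mf_one (t : ℝ) : X.mf ν 1 t = X.n₃ ν 1 t := X.mf_of_half_le (by norm_num) t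

/-- The phase-`0` end framing on the window. [folklore] -/
theorem νfam_half_window {s : ℝ} (hs : |sdist X.s₀ s| < X.w₀) :
    X.νfam ν (1 / 2) (circlePt s) =
      X.bv (sdist X.s₀ s • DarbouxData.e 0) (X.n₃ ν 1 (sdist X.s₀ s)) := by
  rw [X.νfam_circlePt, FF, if_pos hs, mf_half, mcurve]
  have h0 : Real.smoothTransition ((2 : ℝ) * (1 / 2) - 1, s).1 = 0 := by
    norm_num [Real.smoothTransition.zero_of_nonpos]
  rw [h0, LegendrianModel.scurve_zero_left _ X.ε_pos.ne', axisPt_eq]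

/-- The end framing on the window. [folklore] -/
theorem νfam_one_window {s : ℝ} (hs : |sdist X.s₀ s| < X.w₀) :
    X.νfam ν 1 (circlePt s) =
      X.bv (LegendrianModel.scurve X.ε 1 (sdist X.s₀ s)) (X.n₃ ν 1 (sdist X.s₀ s)) := by
  rw [X.νfam_circlePt, FF, if_pos hs, mf_one, mcurve]
  have h1 : Real.smoothTransition ((2 : ℝ) * 1 - 1, s).1 = 1 := by
    norm_num [Real.smoothTransition.one_of_one_le]
  rw [h1]

/-- Off the window both framings are the given one. [folklore] -/
theorem νfam_of_le {s : ℝ} (hs : X.w₀ ≤ |sdist X.s₀ s|) (r : ℝ) : X.νfam ν r (circlePt s) = ν (circlePt s) := by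
  rw [X.νfam_circlePt, FF, if_neg (not_lt.2 hs)]

/-- **The twisting loop of `(K, ν♯)` on the window**, `ν♯ = νfam (1/2)` the phase-`0` end framing
with box coordinates `m = n₃ 1 t̂`: `(g m₁ + ∂₀g m₂) + i g m₂` at the axis point. [folklore] -/
theorem twistingLoop_sharp_window {s : ℝ} (hs : |sdist X.s₀ s| < X.w₀) :
    S.twistingLoop X.K (X.νfam ν (1 / 2)) s =
      ⟨X.D.g (sdist X.s₀ s • DarbouxData.e 0) * X.n₃ ν 1 (sdist X.s₀ s) 1 +
          fderiv ℝ X.D.g (sdist X.s₀ s • DarbouxData.e 0) (DarbouxData.e 0) * X.n₃ ν 1 (sdist X.s₀ s) 2,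
        X.D.g (sdist X.s₀ s • DarbouxData.e 0) * X.n₃ ν 1 (sdist X.s₀ s) 2⟩ := by
  have hℓ : |sdist X.s₀ s| < X.ℓ := hs.trans X.w₀_lt_ℓ
  have hV := X.axis_mem_V hℓ
  have hKd : MDifferentiable (𝓡 1) (𝓡∂ 4) X.K :=
    X.legendrian.isSmoothEmbedding.contMDiff.mdifferentiable (by simp)
  rw [SteinStructure.twistingLoop_apply, X.νfam_half_window hs,
    knotVelocity_eq_of_circlePt_eq hKd (circlePt_add_sdist X.s₀ s).symm, X.knotVelocity_K_axis hℓ,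
    ← circlePt_add_sdist X.s₀ s, ← X.bpt_axis hℓ, X.kahlerForm_bv hV, X.contactForm_bv hV]
  apply Complex.ext <;> simp [DarbouxData.e_apply]

/-- **The twisting loop of `(K₁, ν')` on the window**, `ν' = νfam 1` with the same box
coordinates `m`: `(g̃ x' m₁ + ∂_d g̃ m₂) + i g̃ m₂` at the point of the stabilised arc
(`z' = y x'`). [folklore] -/
theorem twistingLoop_end_window {s : ℝ} (hs : |sdist X.s₀ s| < X.w₀) :
    S.twistingLoop (X.knot 1) (X.νfam ν 1) s =
      ⟨X.D.g (LegendrianModel.scurve X.ε 1 (sdist X.s₀ s)) *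
            (LegendrianModel.dscurve X.ε 1 (sdist X.s₀ s) 0 * X.n₃ ν 1 (sdist X.s₀ s) 1 -
              LegendrianModel.dscurve X.ε 1 (sdist X.s₀ s) 1 * X.n₃ ν 1 (sdist X.s₀ s) 0) +
          fderiv ℝ X.D.g (LegendrianModel.scurve X.ε 1 (sdist X.s₀ s))
              (LegendrianModel.dscurve X.ε 1 (sdist X.s₀ s)) *
            (X.n₃ ν 1 (sdist X.s₀ s) 2 -
              LegendrianModel.scurve X.ε 1 (sdist X.s₀ s) 1 * X.n₃ ν 1 (sdist X.s₀ s) 0),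
        X.D.g (LegendrianModel.scurve X.ε 1 (sdist X.s₀ s)) *
          (X.n₃ ν 1 (sdist X.s₀ s) 2 -
            LegendrianModel.scurve X.ε 1 (sdist X.s₀ s) 1 * X.n₃ ν 1 (sdist X.s₀ s) 0)⟩ := by
  have hs' : s ∈ X.winSet := hs
  have hV : LegendrianModel.scurve X.ε 1 (sdist X.s₀ s) ∈ X.D.V := by
    have := X.box_subset_V (X.mcurve_mem_box (q := (1, s)) hs)
    rwa [mcurve_one] at this
  rw [SteinStructure.twistingLoop_apply, X.νfam_one_window hs, X.knotVelocity_knot_window hs',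
    Real.smoothTransition.one, mcurve_one, knot_circlePt, X.G_eq_of_mem_winSet hs', mcurve_one,
    show X.Wpt (LegendrianModel.scurve X.ε 1 (sdist X.s₀ s)) =
      X.bpt (LegendrianModel.scurve X.ε 1 (sdist X.s₀ s)) from rfl,
    X.kahlerForm_bv hV, X.contactForm_bv hV, LegendrianModel.dscurve_one_legendrian]
  apply Complex.ext
  · simp only; ring
  · rfl

/-- **Off `|t̂| < 4ε` the two twisting loops agree.** [folklore] -/
theorem twistingLoop_end_eq_sharp {s : ℝ} (hs : 4 * X.ε ≤ |sdist X.s₀ s|) :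
    S.twistingLoop (X.knot 1) (X.νfam ν 1) s = S.twistingLoop X.K (X.νfam ν (1 / 2)) s := by
  by_cases hw : |sdist X.s₀ s| < X.w₀
  · rw [X.twistingLoop_end_window hw, X.twistingLoop_sharp_window hw,
      LegendrianModel.scurve_eq_axisPt X.ε_pos hs, axisPt_eq, dscurve_eq_e0 X.ε_pos hs]
    apply Complex.ext <;> simp [DarbouxData.e_apply]
  · have hfar : s ∈ X.farSet := X.mem_farSet_of_le (not_lt.1 hw)
    rw [SteinStructure.twistingLoop_apply, SteinStructure.twistingLoop_apply, X.νfam_of_le (not_lt.1 hw),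
      X.νfam_of_le (not_lt.1 hw), X.knotVelocity_knot_far hfar, knot_circlePt, X.G_of_le (not_lt.1 hw)]

/-- The phase-`0` end framing is a framing of `K`. [folklore] -/
theorem isKnotFraming_νfam_half (hν : IsKnotFraming X.K ν) : IsKnotFraming X.K (X.νfam ν (1 / 2)) := by
  have h := X.isKnotFraming_νfam hν (1 / 2)
  rwa [show (2 : ℝ) * (1 / 2) - 1 = 0 by norm_num, knot_zero] at h

/-- The end framing is a framing of `K₁`. [folklore] -/
theorem isKnotFraming_νfam_one (hν : IsKnotFraming X.K ν) : IsKnotFraming (X.knot 1) (X.νfam ν 1) := by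
  have h := X.isKnotFraming_νfam hν 1
  rwa [show (2 : ℝ) * 1 - 1 = 1 by norm_num] at h

omit [T2Space W] in
/-- The twisting loop of a framing of a Legendrian knot is continuous. [folklore] -/
theorem _root_.Literature.Geometry.Symplectic.IsKnotFraming.continuous_twistingLoop [T2Space W]
    {K : 𝕊 1 → W} {μ : 𝕊 1 → E4} (hμ : IsKnotFraming K μ) (hK : IsLegendrianKnot S.J K) :
    Continuous (S.twistingLoop K μ) := by
  have h := continuousOn_twistingLoop_family S hK (IsFramingAlong.refl hK.isBoundaryKnot hμ)
  have h2 : Continuous fun t : ℝ => ((0 : ℝ), t) := continuous_const.prodMk continuous_id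
  have h3 := h.comp_continuous h2 fun t => ⟨⟨le_rfl, zero_le_one⟩, mem_univ _⟩
  exact h3

/-- The twisting loop of a framing of a Legendrian knot is a nonvanishing loop. [folklore] -/
theorem isNonvanishingLoop_twistingLoop {K : 𝕊 1 → W} {μ : 𝕊 1 → E4} (hμ : IsKnotFraming K μ)
    (hK : IsLegendrianKnot S.J K) (a : ℝ) : IsNonvanishingLoop fun t => S.twistingLoop K μ (t + a) := by
  have hKd : MDifferentiable (𝓡 1) (𝓡∂ 4) K := hK.isSmoothEmbedding.contMDiff.mdifferentiable (by simp)
  refine ⟨((hμ.continuous_twistingLoop hK).comp (continuous_id.add continuous_const : Continuous fun t : ℝ => t + a)).continuousOn,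
    fun t _ => hμ.twistingLoop_ne_zero hK _, ?_⟩
  show S.twistingLoop K μ (0 + a) = S.twistingLoop K μ (1 + a)
  rw [zero_add, add_comm, S.twistingLoop_add_one hKd]

end TwistingLoops


/-! ### Twisting: the winding computation -/

section TwistingWind

open Literature.Topology.PlaneTopology

variable {ν : 𝕊 1 → E4}

/-- `sdist (s₀ + 1/2) = 1/2`. [folklore] -/
theorem sdist_add_half (s₀ : ℝ) : sdist s₀ (s₀ + 1 / 2) = 1 / 2 := by
  rw [sdist, show s₀ + 1 / 2 - s₀ = (1 / 2 : ℝ) by ring, toIocMod_eq_self]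
  constructor <;> norm_num

/-- `sdist (s₀ - 1/2) = 1/2`. [folklore] -/
theorem sdist_sub_half (s₀ : ℝ) : sdist s₀ (s₀ - 1 / 2) = 1 / 2 := by
  rw [sdist, show s₀ - 1 / 2 - s₀ = -(1 / 2 : ℝ) by ring, toIocMod_apply_left]
  norm_num

/-- The signed distance in the shifted parameter: `|sdist (x + s₀ - 1/2)| = |x - 1/2|` for
`x ∈ [0, 1]`. [folklore] -/
theorem abs_sdist_shift {x : ℝ} (hx : x ∈ Icc (0 : ℝ) 1) :
    |sdist X.s₀ (x + (X.s₀ - 1 / 2))| = |x - 1 / 2| := by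
  rcases eq_or_lt_of_le hx.1 with h0 | h0
  · rw [← h0, zero_add, zero_sub, sdist_sub_half, abs_neg, abs_of_pos (by norm_num : (0 : ℝ) < 1 / 2)]
  rcases eq_or_lt_of_le hx.2 with h1 | h1
  · rw [h1, show (1 : ℝ) + (X.s₀ - 1 / 2) = X.s₀ + 1 / 2 by ring, sdist_add_half]
    norm_num
  · have hlt : |x + (X.s₀ - 1 / 2) - X.s₀| < 1 / 2 := by
      rw [show x + (X.s₀ - 1 / 2) - X.s₀ = x - 1 / 2 by ring, abs_lt]
      constructor <;> linarith
    rw [sdist_eq_sub hlt]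
    ring_nf

/-- On the core of the window the shifted signed distance is `x - 1/2`. [folklore] -/
theorem sdist_shift_of_le {x : ℝ} (hx : |x - 1 / 2| ≤ 4 * X.ε) :
    sdist X.s₀ (x + (X.s₀ - 1 / 2)) = x - 1 / 2 := by
  have h : |x - 1 / 2| < 1 / 2 := lt_of_le_of_lt hx (by linarith [X.twelve_ε_lt_w₀, X.w₀_le, X.ε_pos])
  rw [sdist_eq_sub (by rw [show x + (X.s₀ - 1 / 2) - X.s₀ = x - 1 / 2 by ring]; exact h)]
  ring

/-- Clamp to `[-4ε, 4ε]`. [folklore] -/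
def tc (t : ℝ) : ℝ := max (-(4 * X.ε)) (min (4 * X.ε) t)

/-- The core clamp is continuous. [folklore] -/
theorem continuous_tc : Continuous X.tc := continuous_const.max (continuous_const.min continuous_id)

/-- The core clamp takes values in `[-4ε, 4ε]`. [folklore] -/
theorem abs_tc_le (t : ℝ) : |X.tc t| ≤ 4 * X.ε :=
  abs_le.2 ⟨le_max_left _ _, max_le (by linarith [X.ε_pos]) (min_le_left _ _)⟩

/-- The core clamp is the identity on the core. [folklore] -/
theorem tc_of_le {t : ℝ} (ht : |t| ≤ 4 * X.ε) : X.tc t = t := by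
  rw [tc, min_eq_right (abs_le.1 ht).2, max_eq_right (abs_le.1 ht).1]

/-- The core clamp takes values in the window. [folklore] -/
theorem abs_tc_lt_w₀ (t : ℝ) : |X.tc t| < X.w₀ := lt_of_le_of_lt (X.abs_tc_le t) X.four_ε_lt_w₀

/-- Clamped axis points lie in `V`. [folklore] -/
theorem tc_axis_mem_V (t : ℝ) : (X.tc t • DarbouxData.e 0 : E3) ∈ X.D.V :=
  X.axis_mem_V ((X.abs_tc_lt_w₀ t).trans X.w₀_lt_ℓ)

/-- Clamped points of the stabilised arc lie in `V`. [folklore] -/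
theorem tc_scurve_mem_V (t : ℝ) : LegendrianModel.scurve X.ε 1 (X.tc t) ∈ X.D.V :=
  X.box_subset_V (X.scurve_mem_box ⟨zero_le_one, le_rfl⟩ (X.abs_tc_lt_w₀ t))

/-- `g` at the (clamped) axis point. [folklore] -/
def gA (t : ℝ) : ℝ := X.D.g (X.tc t • DarbouxData.e 0)

/-- `∂₀ g` at the (clamped) axis point. [folklore] -/
def gA' (t : ℝ) : ℝ := fderiv ℝ X.D.g (X.tc t • DarbouxData.e 0) (DarbouxData.e 0)

/-- `g` at the (clamped) point of the stabilised arc. [folklore] -/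
def gS (t : ℝ) : ℝ := X.D.g (LegendrianModel.scurve X.ε 1 (X.tc t))

/-- `∂_d g` at the (clamped) point of the stabilised arc. [folklore] -/
def gS' (t : ℝ) : ℝ :=
  fderiv ℝ X.D.g (LegendrianModel.scurve X.ε 1 (X.tc t)) (LegendrianModel.dscurve X.ε 1 (X.tc t))

/-- `g > 0` at the clamped axis point. [folklore] -/
theorem gA_pos (t : ℝ) : 0 < X.gA t := X.D.g_pos (X.tc_axis_mem_V t)

/-- `g > 0` at the clamped arc point. [folklore] -/
theorem gS_pos (t : ℝ) : 0 < X.gS t := X.D.g_pos (X.tc_scurve_mem_V t)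

/-- `g` at the clamped axis point is continuous. [folklore] -/
theorem continuous_gA : Continuous X.gA := by
  have hl : Continuous fun t : ℝ => (X.tc t • DarbouxData.e 0 : E3) := X.continuous_tc.smul continuous_const
  exact continuous_iff_continuousAt.2 fun t =>
    ContinuousAt.comp (f := fun t : ℝ => (X.tc t • DarbouxData.e 0 : E3))
      (X.D.contDiffAt_g (X.tc_axis_mem_V t)).continuousAt hl.continuousAt

/-- `∂₀ g` at the clamped axis point is continuous. [folklore] -/
theorem continuous_gA' : Continuous X.gA' := by
  have hl : Continuous fun t : ℝ => (X.tc t • DarbouxData.e 0 : E3) := X.continuous_tc.smul continuous_const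
  refine continuous_iff_continuousAt.2 fun t => ?_
  have hD : ContinuousAt (fun t : ℝ => fderiv ℝ X.D.g (X.tc t • DarbouxData.e 0)) t :=
    ContinuousAt.comp (f := fun t : ℝ => (X.tc t • DarbouxData.e 0 : E3))
      ((X.D.contDiffAt_g (X.tc_axis_mem_V t)).fderiv_right (m := 0) (by norm_num)).continuousAt
      hl.continuousAt
  exact hD.clm_apply continuousAt_const

/-- The clamped arc point is continuous. [folklore] -/
theorem continuous_tc_scurve : Continuous fun t : ℝ => LegendrianModel.scurve X.ε 1 (X.tc t) :=
  (LegendrianModel.contDiff_scurve X.ε).continuous.comp (continuous_const.prodMk X.continuous_tc)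

/-- `g` at the clamped arc point is continuous. [folklore] -/
theorem continuous_gS : Continuous X.gS :=
  continuous_iff_continuousAt.2 fun t =>
    ContinuousAt.comp (f := fun t : ℝ => LegendrianModel.scurve X.ε 1 (X.tc t))
      (X.D.contDiffAt_g (X.tc_scurve_mem_V t)).continuousAt X.continuous_tc_scurve.continuousAt

/-- `∂_d g` at the clamped arc point is continuous. [folklore] -/
theorem continuous_gS' : Continuous X.gS' := by
  refine continuous_iff_continuousAt.2 fun t => ?_
  have hD : ContinuousAt (fun t : ℝ => fderiv ℝ X.D.g (LegendrianModel.scurve X.ε 1 (X.tc t))) t :=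
    ContinuousAt.comp (f := fun t : ℝ => LegendrianModel.scurve X.ε 1 (X.tc t))
      ((X.D.contDiffAt_g (X.tc_scurve_mem_V t)).fderiv_right (m := 0) (by norm_num)).continuousAt
      X.continuous_tc_scurve.continuousAt
  have hd : Continuous fun t : ℝ => LegendrianModel.dscurve X.ε 1 (X.tc t) :=
    (continuous_dscurve X.ε).comp (continuous_const.prodMk X.continuous_tc)
  exact hD.clm_apply hd.continuousAt

/-- At `|t| ≥ 4ε` the clamped arc point is the clamped axis point. [folklore] -/
theorem gS_eq_gA_of {t : ℝ} (ht : 4 * X.ε ≤ |t|) : X.gS t = X.gA t := by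
  have h : |X.tc t| = 4 * X.ε := by
    rcases le_abs'.1 ht with h | h
    · rw [tc, min_eq_right (by linarith [X.ε_pos]), max_eq_left (by linarith), abs_neg,
        abs_of_pos (by linarith [X.ε_pos])]
    · rw [tc, min_eq_left h, max_eq_right (by linarith [X.ε_pos]), abs_of_pos (by linarith [X.ε_pos])]
  rw [gS, gA, LegendrianModel.scurve_eq_axisPt X.ε_pos h.ge, axisPt_eq]

/-- At `|t| ≥ 4ε` the two directional derivatives of `g` agree. [folklore] -/
theorem gS'_eq_gA'_of {t : ℝ} (ht : 4 * X.ε ≤ |t|) : X.gS' t = X.gA' t := by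
  have h : |X.tc t| = 4 * X.ε := by
    rcases le_abs'.1 ht with h | h
    · rw [tc, min_eq_right (by linarith [X.ε_pos]), max_eq_left (by linarith), abs_neg,
        abs_of_pos (by linarith [X.ε_pos])]
    · rw [tc, min_eq_left h, max_eq_right (by linarith [X.ε_pos]), abs_of_pos (by linarith [X.ε_pos])]
  rw [gS', gA', LegendrianModel.scurve_eq_axisPt X.ε_pos h.ge, axisPt_eq, dscurve_eq_e0 X.ε_pos h.ge]

/-- **The denominators of the homotopy** (shear `σ` of the loop of `(K, ν♯)`). [folklore] -/
def Dσ (σ t : ℝ) : ℂ :=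
  ⟨X.gA t * LegendrianModel.pfr (t / X.ε) + σ * X.gA' t * LegendrianModel.qfr (t / X.ε),
    X.gA t * LegendrianModel.qfr (t / X.ε)⟩

/-- **The numerators of the homotopy** (shear `σ` of the loop of `(K₁, ν')`). [folklore] -/
def Nσ (σ t : ℝ) : ℂ :=
  ⟨X.gS t * (LegendrianModel.xd (t / X.ε) * LegendrianModel.pfr (t / X.ε)) +
      σ * X.gS' t * LegendrianModel.qfr (t / X.ε),
    X.gS t * LegendrianModel.qfr (t / X.ε)⟩

/-- The denominators never vanish (`fr ≠ 0`, `g > 0`). [folklore] -/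
theorem Dσ_ne_zero (σ t : ℝ) : X.Dσ σ t ≠ 0 := by
  intro h
  have hg := X.gA_pos t
  have h2 : X.gA t * LegendrianModel.qfr (t / X.ε) = 0 := by simpa [Dσ] using congrArg Complex.im h
  have hq : LegendrianModel.qfr (t / X.ε) = 0 := by
    rcases mul_eq_zero.1 h2 with h | h
    · linarith
    · exact h
  have h1 : X.gA t * LegendrianModel.pfr (t / X.ε) + σ * X.gA' t * LegendrianModel.qfr (t / X.ε) = 0 := by
    simpa [Dσ] using congrArg Complex.re h
  rw [hq, mul_zero, add_zero] at h1
  have hp : LegendrianModel.pfr (t / X.ε) = 0 := by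
    rcases mul_eq_zero.1 h1 with h | h
    · linarith
    · exact h
  exact LegendrianModel.qfr_ne_zero_of_pfr_eq_zero hp hq

/-- The numerators never vanish (`v₁ ≠ 0`, `g̃ > 0`). [folklore] -/
theorem Nσ_ne_zero (σ t : ℝ) : X.Nσ σ t ≠ 0 := by
  intro h
  have hg := X.gS_pos t
  have h2 : X.gS t * LegendrianModel.qfr (t / X.ε) = 0 := by simpa [Nσ] using congrArg Complex.im h
  have hq : LegendrianModel.qfr (t / X.ε) = 0 := by
    rcases mul_eq_zero.1 h2 with h | h
    · linarith
    · exact h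
  have h1 : X.gS t * (LegendrianModel.xd (t / X.ε) * LegendrianModel.pfr (t / X.ε)) +
      σ * X.gS' t * LegendrianModel.qfr (t / X.ε) = 0 := by
    simpa [Nσ] using congrArg Complex.re h
  rw [hq, mul_zero, add_zero] at h1
  have hxp : LegendrianModel.xd (t / X.ε) * LegendrianModel.pfr (t / X.ε) = 0 := by
    rcases mul_eq_zero.1 h1 with h | h
    · linarith
    · exact h
  have hv : LegendrianModel.v1 (t / X.ε) = 0 := Complex.ext (by simp [LegendrianModel.v1, hxp])
    (by simp [LegendrianModel.v1, hq])
  have := LegendrianModel.exp_l1 (t / X.ε)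
  rw [hv] at this
  exact Complex.exp_ne_zero _ this

/-- A map into `ℂ` with continuous real and imaginary parts is continuous. [folklore] -/
theorem continuous_complex_mk' {P : Type*} [TopologicalSpace P]
    {f g : P → ℝ} (hf : Continuous f) (hg : Continuous g) : Continuous fun p => (⟨f p, g p⟩ : ℂ) := by
  have h : Continuous fun p => ((f p : ℂ) + (g p : ℂ) * Complex.I) :=
    (Complex.continuous_ofReal.comp hf).add ((Complex.continuous_ofReal.comp hg).mul continuous_const)
  exact h.congr fun p => (Complex.mk_eq_add_mul_I _ _).symm

/-- The denominators are jointly continuous. [folklore] -/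
theorem continuous_Dσ : Continuous fun q : ℝ × ℝ => X.Dσ q.1 q.2 := by
  have hp : Continuous fun q : ℝ × ℝ => LegendrianModel.pfr (q.2 / X.ε) :=
    LegendrianModel.continuous_pfr.comp (continuous_snd.div_const _)
  have hq : Continuous fun q : ℝ × ℝ => LegendrianModel.qfr (q.2 / X.ε) :=
    LegendrianModel.continuous_qfr.comp (continuous_snd.div_const _)
  have hg : Continuous fun q : ℝ × ℝ => X.gA q.2 := X.continuous_gA.comp continuous_snd
  have hg' : Continuous fun q : ℝ × ℝ => X.gA' q.2 := X.continuous_gA'.comp continuous_snd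
  exact continuous_complex_mk'
    (f := fun q : ℝ × ℝ => X.gA q.2 * LegendrianModel.pfr (q.2 / X.ε) + q.1 * X.gA' q.2 * LegendrianModel.qfr (q.2 / X.ε))
    (g := fun q : ℝ × ℝ => X.gA q.2 * LegendrianModel.qfr (q.2 / X.ε))
    ((hg.mul hp).add ((continuous_fst.mul hg').mul hq)) (hg.mul hq)

/-- The numerators are jointly continuous. [folklore] -/
theorem continuous_Nσ : Continuous fun q : ℝ × ℝ => X.Nσ q.1 q.2 := by
  have hp : Continuous fun q : ℝ × ℝ => LegendrianModel.pfr (q.2 / X.ε) :=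
    LegendrianModel.continuous_pfr.comp (continuous_snd.div_const _)
  have hq : Continuous fun q : ℝ × ℝ => LegendrianModel.qfr (q.2 / X.ε) :=
    LegendrianModel.continuous_qfr.comp (continuous_snd.div_const _)
  have hx : Continuous fun q : ℝ × ℝ => LegendrianModel.xd (q.2 / X.ε) :=
    LegendrianModel.continuous_xd.comp (continuous_snd.div_const _)
  have hg : Continuous fun q : ℝ × ℝ => X.gS q.2 := X.continuous_gS.comp continuous_snd
  have hg' : Continuous fun q : ℝ × ℝ => X.gS' q.2 := X.continuous_gS'.comp continuous_snd
  exact continuous_complex_mk'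
    (f := fun q : ℝ × ℝ => X.gS q.2 * (LegendrianModel.xd (q.2 / X.ε) * LegendrianModel.pfr (q.2 / X.ε)) +
      q.1 * X.gS' q.2 * LegendrianModel.qfr (q.2 / X.ε))
    (g := fun q : ℝ × ℝ => X.gS q.2 * LegendrianModel.qfr (q.2 / X.ε))
    ((hg.mul (hx.mul hp)).add ((continuous_fst.mul hg').mul hq)) (hg.mul hq)

/-- At `t = ±4ε` numerator and denominator agree. [folklore] -/
theorem Nσ_eq_Dσ_of {t : ℝ} (ht : |t| = 4 * X.ε) (σ : ℝ) : X.Nσ σ t = X.Dσ σ t := by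
  have hx : LegendrianModel.xd (t / X.ε) = 1 := by
    apply LegendrianModel.xd_eq_one_of_le_abs
    rw [abs_div, abs_of_pos X.ε_pos, ht, le_div_iff₀ X.ε_pos]; linarith [X.ε_pos]
  simp only [Nσ, Dσ, X.gS_eq_gA_of ht.ge, X.gS'_eq_gA'_of ht.ge, hx, one_mul]

/-- **The homotopy of ratio loops**, in the shifted parameter `x` (`t̂ = x - 1/2`). [folklore] -/
def ρ (σ x : ℝ) : ℂ :=
  if |x - 1 / 2| ≤ 4 * X.ε then X.Nσ σ (x - 1 / 2) / X.Dσ σ (x - 1 / 2) else 1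

/-- The homotopy of ratio loops is jointly continuous. [folklore] -/
theorem continuous_ρ : Continuous fun q : ℝ × ℝ => X.ρ q.1 q.2 := by
  have hN := X.continuous_Nσ.comp (continuous_fst.prodMk (continuous_snd.sub continuous_const) :
    Continuous fun q : ℝ × ℝ => (q.1, q.2 - 1 / 2))
  have hD := X.continuous_Dσ.comp (continuous_fst.prodMk (continuous_snd.sub continuous_const) :
    Continuous fun q : ℝ × ℝ => (q.1, q.2 - 1 / 2))
  have hQ := hN.div hD fun q => X.Dσ_ne_zero _ _
  refine Continuous.if_le hQ continuous_const ((continuous_snd.sub continuous_const).abs) continuous_const ?_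
  rintro ⟨σ, x⟩ (h : |x - 1 / 2| = 4 * X.ε)
  show X.Nσ σ (x - 1 / 2) / X.Dσ σ (x - 1 / 2) = 1
  rw [X.Nσ_eq_Dσ_of h, div_self (X.Dσ_ne_zero _ _)]

/-- The homotopy of ratio loops avoids `0`. [folklore] -/
theorem ρ_ne_zero (σ x : ℝ) : X.ρ σ x ≠ 0 := by
  unfold ρ; split_ifs
  · exact div_ne_zero (X.Nσ_ne_zero _ _) (X.Dσ_ne_zero _ _)
  · exact one_ne_zero

/-- The core is shorter than half a period. [folklore] -/
theorem half_gt : 4 * X.ε < 1 / 2 := by linarith [X.twelve_ε_lt_w₀, X.w₀_le, X.ε_pos]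

/-- Every ratio loop starts at `1`. [folklore] -/
theorem ρ_zero_right (σ : ℝ) : X.ρ σ 0 = 1 := by
  rw [ρ, if_neg]
  rw [zero_sub, abs_neg, abs_of_pos (by norm_num : (0 : ℝ) < 1 / 2), not_le]
  exact X.half_gt

/-- Every ratio loop ends at `1`. [folklore] -/
theorem ρ_one_right (σ : ℝ) : X.ρ σ 1 = 1 := by
  rw [ρ, if_neg]
  rw [show (1 : ℝ) - 1 / 2 = 1 / 2 by norm_num, abs_of_pos (by norm_num : (0 : ℝ) < 1 / 2), not_le]
  exact X.half_gt

/-- The sheared and unsheared ratio loops have the same winding number. [folklore] -/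
theorem wind_ρ_one_eq : wind (X.ρ 1) = wind (X.ρ 0) := by
  symm
  refine Literature.Probability.RandomPlanarGeometry.wind_eq_of_homotopy X.ρ X.continuous_ρ.continuousOn
    (fun σ _ x _ => X.ρ_ne_zero σ x) (fun σ _ => by rw [X.ρ_zero_right, X.ρ_one_right])

/-- **The explicit logarithm of `ρ 0`.** [folklore] -/
def Λ (x : ℝ) : ℂ :=
  (Real.log (X.gS (x - 1 / 2) / X.gA (x - 1 / 2)) : ℂ) +
    (LegendrianModel.l1 ((x - 1 / 2) / X.ε) - LegendrianModel.l1 (-2)) -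
    (LegendrianModel.l0 ((x - 1 / 2) / X.ε) - LegendrianModel.l0 (-2))

/-- The explicit logarithm is continuous. [folklore] -/
theorem continuous_Λ : Continuous X.Λ := by
  have h1 : Continuous fun x : ℝ => Real.log (X.gS (x - 1 / 2) / X.gA (x - 1 / 2)) :=
    Continuous.log ((X.continuous_gS.comp (continuous_id.sub continuous_const)).div
      (X.continuous_gA.comp (continuous_id.sub continuous_const)) fun x => (X.gA_pos _).ne')
      fun x => (div_pos (X.gS_pos _) (X.gA_pos _)).ne'
  unfold Λ
  exact ((Complex.continuous_ofReal.comp h1).add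
    ((LegendrianModel.continuous_l1.comp ((continuous_id.sub continuous_const).div_const _)).sub
      continuous_const)).sub
    ((LegendrianModel.continuous_l0.comp ((continuous_id.sub continuous_const).div_const _)).sub
      continuous_const)

/-- The unsheared numerator is `g̃ · v₁`. [folklore] -/
theorem Nσ_zero (t : ℝ) : X.Nσ 0 t = (X.gS t : ℂ) * LegendrianModel.v1 (t / X.ε) :=
  Complex.ext (by simp [Nσ, LegendrianModel.v1]) (by simp [Nσ, LegendrianModel.v1])

/-- The unsheared denominator is `g · v₀`. [folklore] -/
theorem Dσ_zero (t : ℝ) : X.Dσ 0 t = (X.gA t : ℂ) * LegendrianModel.v0 (t / X.ε) :=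
  Complex.ext (by simp [Dσ, LegendrianModel.v0]) (by simp [Dσ, LegendrianModel.v0])

/-- `exp Λ = ρ 0`. [folklore] -/
theorem exp_Λ (x : ℝ) : Complex.exp (X.Λ x) = X.ρ 0 x := by
  have hε := X.ε_pos
  have ht0 := LegendrianModel.t0_lt_one
  have hv0 : LegendrianModel.v0 (-2) = Complex.I := LegendrianModel.v0_of_le (by linarith)
  have hv1 : LegendrianModel.v1 (-2) = Complex.I := LegendrianModel.v1_of_le (by linarith)
  have hE : Complex.exp (X.Λ x) = (X.gS (x - 1 / 2) / X.gA (x - 1 / 2) : ℝ) *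
      LegendrianModel.v1 ((x - 1 / 2) / X.ε) / LegendrianModel.v0 ((x - 1 / 2) / X.ε) := by
    rw [Λ, Complex.exp_sub, Complex.exp_add, Complex.exp_sub, Complex.exp_sub, LegendrianModel.exp_l1,
      LegendrianModel.exp_l1, LegendrianModel.exp_l0, LegendrianModel.exp_l0, hv0, hv1, ← Complex.ofReal_exp,
      Real.exp_log (div_pos (X.gS_pos _) (X.gA_pos _))]
    field_simp
  rw [hE, ρ]
  split_ifs with h
  · -- the core of the window
    have hgA : (X.gA (x - 1 / 2) : ℂ) ≠ 0 := Complex.ofReal_ne_zero.2 (X.gA_pos (x - 1 / 2)).ne'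
    have hv : LegendrianModel.v0 ((x - 1 / 2) / X.ε) ≠ 0 := LegendrianModel.v0_ne_zero _
    rw [Nσ_zero, Dσ_zero, Complex.ofReal_div]
    field_simp
  · -- off the core: everything is trivial
    rw [not_le] at h
    rw [X.gS_eq_gA_of h.le, div_self (X.gA_pos _).ne', Complex.ofReal_one, one_mul]
    have h2 : 2 < |(x - 1 / 2) / X.ε| := by
      rw [abs_div, abs_of_pos X.ε_pos, lt_div_iff₀ X.ε_pos]; linarith
    rcases lt_abs.1 h2 with h2 | h2
    · rw [LegendrianModel.v1_of_ge (by linarith), LegendrianModel.v0_of_ge (by linarith),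
        div_self Complex.I_ne_zero]
    · rw [LegendrianModel.v1_of_le (by linarith), LegendrianModel.v0_of_le (by linarith),
        div_self Complex.I_ne_zero]

/-- `Λ 1 = 2πi`. [folklore] -/
theorem Λ_one : X.Λ 1 = 2 * Real.pi * Complex.I := by
  have hε := X.ε_pos
  have h4 := X.half_gt
  have ht : (1 : ℝ) - 1 / 2 = 1 / 2 := by norm_num
  have hp : 4 * X.ε ≤ |(1 : ℝ) / 2| := by rw [abs_of_pos (by norm_num : (0:ℝ) < 1 / 2)]; linarith
  have hu : (2 : ℝ) ≤ 1 / 2 / X.ε := by rw [le_div_iff₀ hε]; linarith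
  have hu' : (2 : ℝ) ≤ |1 / 2 / X.ε| := by rw [abs_of_nonneg (by positivity)]; exact hu
  rw [Λ, ht, X.gS_eq_gA_of hp, div_self (X.gA_pos _).ne', Real.log_one, Complex.ofReal_zero, zero_add,
    LegendrianModel.l1_eq_of_ge hu, LegendrianModel.l0_eq hu', LegendrianModel.l0_eq (by norm_num),
    sub_self, sub_zero, LegendrianModel.l1_two_sub]

/-- `Λ 0 = 0`. [folklore] -/
theorem Λ_zero : X.Λ 0 = 0 := by
  have hε := X.ε_pos
  have h4 := X.half_gt
  have ht : (0 : ℝ) - 1 / 2 = -(1 / 2) := by norm_num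
  have hp : 4 * X.ε ≤ |(-(1 / 2) : ℝ)| := by
    rw [abs_neg, abs_of_pos (by norm_num : (0:ℝ) < 1 / 2)]; linarith
  have hu : -(1 / 2) / X.ε ≤ (-2 : ℝ) := by rw [div_le_iff₀ hε]; linarith
  have hu' : (2 : ℝ) ≤ |-(1 / 2) / X.ε| := by rw [abs_of_nonpos (by linarith)]; linarith
  rw [Λ, ht, X.gS_eq_gA_of hp, div_self (X.gA_pos _).ne', Real.log_one, Complex.ofReal_zero, zero_add,
    LegendrianModel.l1_eq_of_le hu, LegendrianModel.l0_eq hu', LegendrianModel.l0_eq (by norm_num),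
    sub_self, sub_self, sub_zero]

/-- The explicit logarithm changes by `2πi` over a period. [folklore] -/
theorem Λ_one_sub_Λ_zero : X.Λ 1 - X.Λ 0 = 2 * Real.pi * Complex.I := by
  rw [Λ_one, Λ_zero, sub_zero]

/-- The unsheared ratio loop has winding number `1`. [folklore] -/
theorem wind_ρ_zero : wind (X.ρ 0) = 1 := by
  have h := wind_spec (f := X.ρ 0) (l := X.Λ) X.continuous_Λ.continuousOn (fun x _ => X.exp_Λ x)
    (by rw [X.ρ_zero_right, X.ρ_one_right])
  rw [Λ_one_sub_Λ_zero] at h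
  apply int_eq_of_mul_two_pi_I_eq
  push_cast
  rw [one_mul]
  exact h.symm

/-- On the core, the loop of `(K, ν♯)` is the denominator. [folklore] -/
theorem twistingLoop_sharp_eq_Dσ {x : ℝ} (hx : |x - 1 / 2| ≤ 4 * X.ε) :
    S.twistingLoop X.K (X.νfam ν (1 / 2)) (x + (X.s₀ - 1 / 2)) = X.Dσ 1 (x - 1 / 2) := by
  have hsd := X.sdist_shift_of_le hx
  have hw : |sdist X.s₀ (x + (X.s₀ - 1 / 2))| < X.w₀ := by rw [hsd]; exact lt_of_le_of_lt hx X.four_ε_lt_w₀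
  rw [X.twistingLoop_sharp_window hw, hsd, X.n₃_of_le le_rfl hx, Dσ, gA, gA', X.tc_of_le hx]
  simp [LegendrianModel.fr]

/-- On the core, the loop of `(K₁, ν')` is the numerator. [folklore] -/
theorem twistingLoop_end_eq_Nσ {x : ℝ} (hx : |x - 1 / 2| ≤ 4 * X.ε) :
    S.twistingLoop (X.knot 1) (X.νfam ν 1) (x + (X.s₀ - 1 / 2)) = X.Nσ 1 (x - 1 / 2) := by
  have hsd := X.sdist_shift_of_le hx
  have hw : |sdist X.s₀ (x + (X.s₀ - 1 / 2))| < X.w₀ := by rw [hsd]; exact lt_of_le_of_lt hx X.four_ε_lt_w₀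
  rw [X.twistingLoop_end_window hw, hsd, X.n₃_of_le le_rfl hx, Nσ, gS, gS', X.tc_of_le hx]
  simp [LegendrianModel.fr, LegendrianModel.dscurve]

/-- **The loops differ by the ratio loop**: `ℓ'(x) = ℓ♯(x) · ρ 1 x` on `[0, 1]`. [folklore] -/
theorem twistingLoop_end_eq_mul {x : ℝ} (hx : x ∈ Icc (0 : ℝ) 1) :
    S.twistingLoop (X.knot 1) (X.νfam ν 1) (x + (X.s₀ - 1 / 2)) =
      S.twistingLoop X.K (X.νfam ν (1 / 2)) (x + (X.s₀ - 1 / 2)) * X.ρ 1 x := by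
  unfold ρ
  split_ifs with h
  · rw [X.twistingLoop_end_eq_Nσ h, X.twistingLoop_sharp_eq_Dσ h, mul_div_cancel₀ _ (X.Dσ_ne_zero _ _)]
  · rw [mul_one]
    apply X.twistingLoop_end_eq_sharp
    rw [X.abs_sdist_shift hx]
    exact (not_le.1 h).le

/-- **The stabilisation adds one twist**:
`twisting K₁ ν' = twisting K ν♯ + 1`. [cite: Gompf1998, §1] -/
theorem twisting_knot_one (hν : IsKnotFraming X.K ν) :
    S.twisting (X.knot 1) (X.νfam ν 1) = S.twisting X.K (X.νfam ν (1 / 2)) + 1 := by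
  have hK1 : IsLegendrianKnot S.J (X.knot 1) := X.isLegendrianKnot_knot_one
  have hν1 := X.isKnotFraming_νfam_one hν
  have hνh := X.isKnotFraming_νfam_half hν
  have hKd : MDifferentiable (𝓡 1) (𝓡∂ 4) X.K := X.legendrian.isSmoothEmbedding.contMDiff.mdifferentiable (by simp)
  have hK1d : MDifferentiable (𝓡 1) (𝓡∂ 4) (X.knot 1) := hK1.isSmoothEmbedding.contMDiff.mdifferentiable (by simp)
  set a : ℝ := X.s₀ - 1 / 2 with ha
  unfold SteinStructure.twisting
  rw [← wind_comp_add_of_periodic (hν1.continuous_twistingLoop hK1) (fun t => hν1.twistingLoop_ne_zero hK1 t)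
      (fun t => S.twistingLoop_add_one hK1d _ t) a,
    ← wind_comp_add_of_periodic (hνh.continuous_twistingLoop X.legendrian)
      (fun t => hνh.twistingLoop_ne_zero X.legendrian t) (fun t => S.twistingLoop_add_one hKd _ t) a]
  rw [wind_congr (g := fun x => S.twistingLoop X.K (X.νfam ν (1 / 2)) (x + a) * X.ρ 1 x)
      (fun x hx => X.twistingLoop_end_eq_mul hx)]
  have hρ : IsNonvanishingLoop (X.ρ 1) :=
    ⟨(X.continuous_ρ.comp (continuous_const.prodMk continuous_id)).continuousOn, fun x _ => X.ρ_ne_zero 1 x,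
      by rw [X.ρ_zero_right, X.ρ_one_right]⟩
  rw [wind_mul (isNonvanishingLoop_twistingLoop hνh X.legendrian a) hρ, wind_ρ_one_eq, wind_ρ_zero]

end TwistingWind


/-! ### `𝒪`-smallness -/

section Small

/-- **`𝒪`-smallness of the stabilising isotopy** from smallness of the transported model curves
over the core of the window. [folklore] -/
theorem isSmall_isotopy₂ {𝒪 : Set ((𝕊 1) × W)} (hK : ∀ u, (u, X.K u) ∈ 𝒪)
    (hsmall : ∀ τ ∈ Icc (0 : ℝ) 1, ∀ t : ℝ, |t| ≤ 4 * X.ε →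
      (circlePt (X.s₀ + t), X.bpt (LegendrianModel.scurve X.ε τ t)) ∈ 𝒪) :
    X.isotopy₂.IsSmall 𝒪 := by
  intro r _ u
  show (u, X.knot (2 * r - 1) u) ∈ 𝒪
  rw [knot]
  set s := angA u with hs
  have hu : circlePt s = u := circlePt_angA u
  by_cases h4 : 4 * X.ε < |sdist X.s₀ s|
  · rw [X.G_eq_K_of_mem h4, hu]; exact hK u
  · have hw : |sdist X.s₀ s| < X.w₀ := lt_of_le_of_lt (not_lt.1 h4) X.four_ε_lt_w₀
    rw [X.G_of_lt hw]
    have := hsmall _ (smoothTransition_mem (2 * r - 1)) _ (not_lt.1 h4)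
    rwa [circlePt_add_sdist, hu] at this

end Small

end StabData

/-! ### Existence of the stabilisation data -/

namespace LegendrianArc

variable {S : SteinStructure W} (A : LegendrianArc S)

/-- `bpt` is continuous on `V`. [folklore] -/
theorem continuousAt_bpt {w : E3} (hw : w ∈ A.darbouxData.V) : ContinuousAt A.bpt w := by
  have h1 : ContinuousAt (fun w' => A.emb (A.darbouxData.Ψ w')) w :=
    A.continuous_emb.continuousAt.comp (DarbouxData.contDiffAt_Ψ (hw := hw)).continuousAt
  have h2 : ContinuousWithinAt A.chart.symm A.chart.target (A.emb (A.darbouxData.Ψ w)) :=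
    (continuousOn_extChartAt_symm A.p) _ (A.emb_Ψ_mem_target hw)
  have h3 : ContinuousWithinAt (fun w' => A.chart.symm (A.emb (A.darbouxData.Ψ w'))) A.darbouxData.V w :=
    ContinuousWithinAt.comp (f := fun w' => A.emb (A.darbouxData.Ψ w')) h2 h1.continuousWithinAt
      fun w' hw' => A.emb_Ψ_mem_target hw'
  exact (continuousWithinAt_iff_continuousAt (A.darbouxData.isOpen_V.mem_nhds hw)).1 h3

/-- `bpt 0 = p`. [folklore] -/
theorem bpt_zero : A.bpt 0 = A.p := by
  have hΨ : A.darbouxData.Ψ 0 = 0 := by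
    have h := A.darbouxData.Ψ_axis (x := 0) (by rw [zero_smul]; exact A.darbouxData.zero_mem_V₀)
      (by rw [zero_smul]; exact A.darbouxData.zero_mem_Φ₁_source)
    rw [zero_smul, add_zero] at h
    rw [h, darbouxData_c, darbouxData_s₀, chat_s₀]
  show A.chart.symm (A.emb (A.darbouxData.Ψ 0)) = A.p
  rw [hΨ, emb_zero]
  exact extChartAt_to_inv (I := 𝓡∂ 4) A.p

/-- The far arc of the knot is a compact set not containing `p`. [folklore] -/
theorem exists_open_nhds_disjoint {w₀ : ℝ} (hw₀ : 0 < w₀) (hw₀' : w₀ ≤ 1 / 4) :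
    ∃ B : Set W, IsOpen B ∧ A.p ∈ B ∧
      ∀ s : ℝ, w₀ ≤ |sdist A.s₀ s| → A.K (circlePt s) ∉ B := by
  set C : Set W := A.K '' (circlePt '' Icc (A.s₀ + w₀) (A.s₀ + 1 - w₀)) with hC
  have hCc : IsCompact C := (isCompact_Icc.image continuous_circlePt).image
    A.legendrian.isSmoothEmbedding.contMDiff.continuous
  have hpC : A.p ∉ C := by
    rintro ⟨u, ⟨s, hs, rfl⟩, hu⟩
    have hinj := A.legendrian.isSmoothEmbedding.isEmbedding.injective hu
    obtain ⟨m, hm⟩ := circlePt_eq_circlePt_iff.1 hinj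
    -- `s = s₀ + m` with `s - s₀ ∈ [w₀, 1 - w₀]`: no integer there
    have h1 : (w₀ : ℝ) ≤ m := by linarith [hs.1]
    have h2 : (m : ℝ) ≤ 1 - w₀ := by linarith [hs.2]
    have h3 : (0 : ℤ) < m := by exact_mod_cast (show (0 : ℝ) < m by linarith)
    have h4 : m < (1 : ℤ) := by exact_mod_cast (show (m : ℝ) < 1 by linarith)
    omega
  refine ⟨Cᶜ, hCc.isClosed.isOpen_compl, hpC, fun s hs hmem => hmem ?_⟩
  -- `K (circlePt s) ∈ C`
  obtain ⟨m, hm⟩ := exists_int_eq_add_sdist A.s₀ s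
  have hmem' := sdist_mem A.s₀ s
  rcases le_abs'.1 hs with h | h
  · refine ⟨circlePt (A.s₀ + sdist A.s₀ s + 1), ⟨A.s₀ + sdist A.s₀ s + 1, ⟨by linarith [hmem'.1], by linarith⟩,
      rfl⟩, ?_⟩
    rw [circlePt_add_one, circlePt_add_sdist]
  · refine ⟨circlePt (A.s₀ + sdist A.s₀ s), ⟨A.s₀ + sdist A.s₀ s, ⟨by linarith, by linarith [hmem'.2]⟩, rfl⟩, ?_⟩
    rw [circlePt_add_sdist]

/-- **Existence of stabilisation data** with `𝒪`-small, separated model curves: the scale `ε` is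
chosen last, small against the window `w₀`, the box `ℓ`, an open neighbourhood of `p` avoiding the
far arc of the knot, and a product neighbourhood of `(c(s₀), p)` inside `𝒪`. [folklore] -/
theorem exists_stabData {𝒪 : Set ((𝕊 1) × W)} (h𝒪 : IsOpen 𝒪) (hK𝒪 : ∀ u, (u, A.K u) ∈ 𝒪) :
    ∃ X : StabData S, X.toLegendrianArc = A ∧
      ∀ τ ∈ Icc (0 : ℝ) 1, ∀ t : ℝ, |t| ≤ 4 * X.ε →
        (circlePt (A.s₀ + t), A.bpt (LegendrianModel.scurve X.ε τ t)) ∈ 𝒪 := by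
  -- the box
  obtain ⟨ℓ, hℓ, hbox, haxis⟩ := A.darbouxData.exists_box
  -- the window
  set w₀ : ℝ := min (ℓ / 2) (1 / 4) with hw₀
  have hw₀_pos : 0 < w₀ := lt_min (by linarith) (by norm_num)
  have hw₀_le : w₀ ≤ 1 / 4 := min_le_right _ _
  have hw₀_ℓ : w₀ ≤ ℓ / 2 := min_le_left _ _
  -- an open neighbourhood of `p` avoiding the far arc, inside the `𝒪`-slice
  obtain ⟨B₁, hB₁o, hpB₁, hfar⟩ := A.exists_open_nhds_disjoint hw₀_pos hw₀_le
  have hp𝒪 : (circlePt A.s₀, A.p) ∈ 𝒪 := hK𝒪 _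
  obtain ⟨A₁, B₂, hA₁o, hB₂o, hA₁, hB₂, hprod⟩ := isOpen_prod_iff.1 h𝒪 _ _ hp𝒪
  set B : Set W := B₁ ∩ B₂ with hB
  have hBo : IsOpen B := hB₁o.inter hB₂o
  have hpB : A.p ∈ B := ⟨hpB₁, hB₂⟩
  -- pull back `B` by `bpt` near `0`, and `A₁` by `circlePt` near `s₀`
  have hpre : bpt A ⁻¹' B ∩ A.darbouxData.V ∈ 𝓝 (0 : E3) := by
    refine Filter.inter_mem ?_ A.darbouxData.V_mem_nhds_zero
    exact (A.continuousAt_bpt A.darbouxData.zero_mem_V).preimage_mem_nhds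
      (hBo.mem_nhds (by rw [bpt_zero]; exact hpB))
  obtain ⟨η, hη, hηsub⟩ := Metric.mem_nhds_iff.1 hpre
  have hpre' : (fun t : ℝ => circlePt (A.s₀ + t)) ⁻¹' A₁ ∈ 𝓝 (0 : ℝ) := by
    have hc : Continuous fun t : ℝ => circlePt (A.s₀ + t) :=
      continuous_circlePt.comp (continuous_const.add continuous_id)
    exact hc.continuousAt.preimage_mem_nhds (hA₁o.mem_nhds (by simpa using hA₁))
  obtain ⟨η', hη', hη'sub⟩ := Metric.mem_nhds_iff.1 hpre'
  -- the scale
  set C := LegendrianModel.Cmodel with hCdef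
  have hC : 0 < C := LegendrianModel.Cmodel_pos
  set ε : ℝ := min (min 1 (w₀ / 16)) (min (ℓ / (4 * C)) (min (η / (2 * (4 + C))) (η' / 8))) with hεdef
  have hε_pos : 0 < ε := by
    simp only [hεdef, lt_min_iff]; refine ⟨⟨one_pos, by positivity⟩, by positivity, by positivity, by positivity⟩
  have hε1 : ε ≤ 1 := (min_le_left _ _).trans (min_le_left _ _)
  have hε2 : ε ≤ w₀ / 16 := (min_le_left _ _).trans (min_le_right _ _)
  have hε3 : ε ≤ ℓ / (4 * C) := (min_le_right _ _).trans (min_le_left _ _)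
  have hε4 : ε ≤ η / (2 * (4 + C)) := (min_le_right _ _).trans ((min_le_right _ _).trans (min_le_left _ _))
  have hε5 : ε ≤ η' / 8 := (min_le_right _ _).trans ((min_le_right _ _).trans (min_le_right _ _))
  have hεC : ε * C ≤ ℓ / 4 := by
    rw [le_div_iff₀ (by positivity)] at hε3; linarith
  -- model curves over the core are `η`-close to `0`
  have hnorm : ∀ τ ∈ Icc (0 : ℝ) 1, ∀ t : ℝ, |t| ≤ 4 * ε → ‖LegendrianModel.scurve ε τ t‖ < η := by
    intro τ hτ t ht
    have h1 := LegendrianModel.norm_scurve_sub_axisPt_le hε_pos hε1 hτ t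
    have h2 : ‖LegendrianModel.axisPt t‖ = |t| := by
      rw [EuclideanSpace.norm_eq]
      simp [Fin.sum_univ_three, Real.sqrt_sq_eq_abs]
    have h3 : ‖LegendrianModel.scurve ε τ t‖ ≤ |t| + ε * C := by
      have := norm_add_le (LegendrianModel.scurve ε τ t - LegendrianModel.axisPt t) (LegendrianModel.axisPt t)
      rw [sub_add_cancel, h2] at this
      linarith
    have h4 : ε * (4 + C) ≤ η / 2 := by
      rw [le_div_iff₀ (by positivity)] at hε4; linarith
    nlinarith
  have hcore : ∀ τ ∈ Icc (0 : ℝ) 1, ∀ t : ℝ, |t| ≤ 4 * ε →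
      A.bpt (LegendrianModel.scurve ε τ t) ∈ B ∧ circlePt (A.s₀ + t) ∈ A₁ := by
    intro τ hτ t ht
    refine ⟨(hηsub (mem_ball_zero_iff.2 (hnorm τ hτ t ht))).1, hη'sub ?_⟩
    rw [mem_ball_zero_iff, Real.norm_eq_abs]
    linarith
  have hf1 : 16 * ε ≤ w₀ := by linarith
  have hf2 : w₀ + ε * LegendrianModel.Cmodel < ℓ := by linarith
  refine ⟨⟨A, ε, w₀, ℓ, hε_pos, hε1, hw₀_le, hf1, hf2, hbox, haxis, ?_⟩, rfl, ?_⟩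
  · intro τ hτ t ht s hs heq
    apply hfar s hs
    have hmem := (hcore τ hτ t ht.le).1
    rw [show A.bpt (LegendrianModel.scurve ε τ t) = (extChartAt (𝓡∂ 4) A.p).symm
      (A.emb (A.darbouxData.Ψ (LegendrianModel.scurve ε τ t))) from rfl, heq] at hmem
    exact hmem.1
  · intro τ hτ t ht
    have h := hcore τ hτ t ht
    exact hprod (mk_mem_prod h.2 h.1.2)

end LegendrianArc

namespace StabData

variable {S : SteinStructure W} (X : StabData S) {ν : 𝕊 1 → E4}

/-- **The given framing and the phase-`0` end framing are homotopic through framings of `K`**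
(the first half of the family `νfam`). [folklore] -/
theorem framingHomotopic_νfam_half (hν : IsKnotFraming X.K ν) :
    FramingHomotopic X.K ν (X.νfam ν (1 / 2)) := by
  refine ⟨X.legendrian.isBoundaryKnot, fun r => X.νfam ν (r / 2), ⟨?_, ?_, ?_⟩, by norm_num⟩
  · show X.νfam ν (0 / 2) = ν
    rw [zero_div]; exact X.νfam_zero hν
  · intro r hr
    have h := X.isKnotFraming_νfam hν (r / 2)
    rwa [X.knot_of_nonpos (show 2 * (r / 2) - 1 ≤ 0 by linarith [hr.2])] at h
  · have hc := X.continuous_total hν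
    have h2 : Continuous fun q : ℝ × (𝕊 1) => (q.1 / 2, q.2) :=
      (continuous_fst.div_const _).prodMk continuous_snd
    have h3 := hc.comp h2
    refine h3.continuousOn.congr ?_
    rintro ⟨r, u⟩ ⟨hr, -⟩
    show (Bundle.TotalSpace.mk' E4 ((KnotIsotopyInBoundary.refl X.legendrian.isBoundaryKnot).toFun r u)
      (X.νfam ν (r / 2) u) : TangentBundle (𝓡∂ 4) W) =
      Bundle.TotalSpace.mk' E4 (X.knot (2 * (r / 2) - 1) u) (X.νfam ν (r / 2) u)
    rw [X.knot_of_nonpos (show 2 * (r / 2) - 1 ≤ 0 by linarith [hr.2])]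
    rfl

end StabData

end LegendrianDarboux

/-! ### Concatenation of isotopies of knots in the boundary and of framing families -/

namespace KnotIsotopyInBoundary

variable {W : Type*} [TopologicalSpace W] [ChartedSpace (EuclideanHalfSpace 4) W] {K₀ K₁ K₂ : 𝕊 1 → W}

/-- Time reparametrisation of the first half: `0` on `t ≤ 0`, `1` on `t ≥ 1/3`. [folklore] -/
def ρ₁ (t : ℝ) : ℝ := Real.smoothTransition (3 * t)

/-- Time reparametrisation of the second half: `0` on `t ≤ 2/3`, `1` on `t ≥ 1`. [folklore] -/
def ρ₂ (t : ℝ) : ℝ := Real.smoothTransition (3 * t - 2)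

/-- `ρ₁` takes values in `[0, 1]`. [folklore] -/
theorem ρ₁_mem (t : ℝ) : ρ₁ t ∈ Icc (0 : ℝ) 1 :=
  ⟨Real.smoothTransition.nonneg _, Real.smoothTransition.le_one _⟩

/-- `ρ₂` takes values in `[0, 1]`. [folklore] -/
theorem ρ₂_mem (t : ℝ) : ρ₂ t ∈ Icc (0 : ℝ) 1 :=
  ⟨Real.smoothTransition.nonneg _, Real.smoothTransition.le_one _⟩

/-- `ρ₁ = 1` on `[1/3, ∞)`. [folklore] -/
theorem ρ₁_of_ge {t : ℝ} (ht : 1 / 3 ≤ t) : ρ₁ t = 1 := Real.smoothTransition.one_of_one_le (by linarith)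

/-- `ρ₂ = 0` on `(-∞, 2/3]`. [folklore] -/
theorem ρ₂_of_le {t : ℝ} (ht : t ≤ 2 / 3) : ρ₂ t = 0 := Real.smoothTransition.zero_of_nonpos (by linarith)

/-- `ρ₁ 0 = 0`. [folklore] -/
@[simp] theorem ρ₁_zero : ρ₁ 0 = 0 := by simp [ρ₁, Real.smoothTransition.zero_of_nonpos]

/-- `ρ₂ 1 = 1`. [folklore] -/
@[simp] theorem ρ₂_one : ρ₂ 1 = 1 := by norm_num [ρ₂, Real.smoothTransition.one_of_one_le]

/-- `ρ₁` is smooth. [folklore] -/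
theorem contDiff_ρ₁ : ContDiff ℝ ∞ ρ₁ := Real.smoothTransition.contDiff.comp (contDiff_const.mul contDiff_id)

/-- `ρ₂` is smooth. [folklore] -/
theorem contDiff_ρ₂ : ContDiff ℝ ∞ ρ₂ :=
  Real.smoothTransition.contDiff.comp ((contDiff_const.mul contDiff_id).sub contDiff_const)

/-- **Concatenation of isotopies of knots in the boundary** (each half reparametrised by a
smooth step function constant near the junction, so that the concatenation is jointly smooth).
[folklore] -/
def trans' (Φ : KnotIsotopyInBoundary K₀ K₁) (Ψ : KnotIsotopyInBoundary K₁ K₂) : KnotIsotopyInBoundary K₀ K₂ where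
  toFun t := if t ≤ 1 / 2 then Φ.toFun (ρ₁ t) else Ψ.toFun (ρ₂ t)
  contMDiff := by
    have hA : ContMDiff (𝓘(ℝ, ℝ).prod (𝓡 1)) (𝓡∂ 4) ∞ fun q : ℝ × (𝕊 1) => Φ.toFun (ρ₁ q.1) q.2 :=
      Φ.contMDiff.comp ((contDiff_ρ₁.contMDiff.comp contMDiff_fst).prodMk contMDiff_snd)
    have hB : ContMDiff (𝓘(ℝ, ℝ).prod (𝓡 1)) (𝓡∂ 4) ∞ fun q : ℝ × (𝕊 1) => Ψ.toFun (ρ₂ q.1) q.2 :=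
      Ψ.contMDiff.comp ((contDiff_ρ₂.contMDiff.comp contMDiff_fst).prodMk contMDiff_snd)
    rintro ⟨t, u⟩
    by_cases ht : t < 2 / 3
    · refine (hA (t, u)).congr_of_eventuallyEq ?_
      have hopen : ∀ᶠ q : ℝ × (𝕊 1) in 𝓝 (t, u), q.1 < 2 / 3 :=
        (isOpen_lt continuous_fst continuous_const).mem_nhds ht
      filter_upwards [hopen] with q hq
      show (if q.1 ≤ 1 / 2 then Φ.toFun (ρ₁ q.1) else Ψ.toFun (ρ₂ q.1)) q.2 = Φ.toFun (ρ₁ q.1) q.2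
      split_ifs with h
      · rfl
      · rw [ρ₂_of_le hq.le, Ψ.map_zero, ρ₁_of_ge (by linarith), Φ.map_one]
    · refine (hB (t, u)).congr_of_eventuallyEq ?_
      have hopen : ∀ᶠ q : ℝ × (𝕊 1) in 𝓝 (t, u), 1 / 2 < q.1 :=
        (isOpen_lt continuous_const continuous_fst).mem_nhds (by simp only [Set.mem_setOf_eq]; linarith [not_lt.1 ht])
      filter_upwards [hopen] with q hq
      show (if q.1 ≤ 1 / 2 then Φ.toFun (ρ₁ q.1) else Ψ.toFun (ρ₂ q.1)) q.2 = Ψ.toFun (ρ₂ q.1) q.2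
      rw [if_neg (not_le.2 hq)]
  isSmoothEmbedding t := by
    by_cases h : t ≤ 1 / 2
    · simp only [h, if_true]; exact Φ.isSmoothEmbedding _
    · simp only [h, if_false]; exact Ψ.isSmoothEmbedding _
  map_zero := by
    show (if (0 : ℝ) ≤ 1 / 2 then Φ.toFun (ρ₁ 0) else Ψ.toFun (ρ₂ 0)) = K₀
    rw [if_pos (by norm_num), ρ₁_zero, Φ.map_zero]
  map_one := by
    show (if (1 : ℝ) ≤ 1 / 2 then Φ.toFun (ρ₁ 1) else Ψ.toFun (ρ₂ 1)) = K₂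
    rw [if_neg (by norm_num), ρ₂_one, Ψ.map_one]
  isBoundaryPoint t _ u := by
    show (𝓡∂ 4).IsBoundaryPoint ((if t ≤ 1 / 2 then Φ.toFun (ρ₁ t) else Ψ.toFun (ρ₂ t)) u)
    split_ifs
    · exact Φ.isBoundaryPoint _ (ρ₁_mem t) u
    · exact Ψ.isBoundaryPoint _ (ρ₂_mem t) u

/-- Stages of the concatenated isotopy. [folklore] -/
theorem trans'_toFun (Φ : KnotIsotopyInBoundary K₀ K₁) (Ψ : KnotIsotopyInBoundary K₁ K₂) (t : ℝ) :
    (Φ.trans' Ψ).toFun t = if t ≤ 1 / 2 then Φ.toFun (ρ₁ t) else Ψ.toFun (ρ₂ t) := rfl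

/-- Concatenation preserves `𝒪`-smallness. [folklore] -/
theorem IsSmall.trans' {Φ : KnotIsotopyInBoundary K₀ K₁} {Ψ : KnotIsotopyInBoundary K₁ K₂}
    {𝒪 : Set ((𝕊 1) × W)} (hΦ : Φ.IsSmall 𝒪) (hΨ : Ψ.IsSmall 𝒪) : (Φ.trans' Ψ).IsSmall 𝒪 := by
  intro t _ u
  rw [trans'_toFun]
  split_ifs
  · exact hΦ _ (ρ₁_mem t) u
  · exact hΨ _ (ρ₂_mem t) u

variable [IsManifold (𝓡∂ 4) ∞ W]

/-- **Concatenation of framing families** along concatenated isotopies. [folklore] -/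
theorem _root_.Literature.Geometry.Symplectic.IsFramingAlong.trans' {Φ : KnotIsotopyInBoundary K₀ K₁}
    {Ψ : KnotIsotopyInBoundary K₁ K₂} {ν : 𝕊 1 → E4} {νt₁ νt₂ : ℝ → 𝕊 1 → E4}
    (h₁ : IsFramingAlong Φ ν νt₁) (h₂ : IsFramingAlong Ψ (νt₁ 1) νt₂) :
    IsFramingAlong (Φ.trans' Ψ) ν (fun t => if t ≤ 1 / 2 then νt₁ (ρ₁ t) else νt₂ (ρ₂ t)) where
  apply_zero := by
    show (if (0 : ℝ) ≤ 1 / 2 then νt₁ (ρ₁ 0) else νt₂ (ρ₂ 0)) = ν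
    rw [if_pos (by norm_num), ρ₁_zero, h₁.apply_zero]
  isKnotFraming t _ := by
    rw [trans'_toFun]
    by_cases h : t ≤ 1 / 2
    · simp only [h, if_true]; exact h₁.isKnotFraming _ (ρ₁_mem t)
    · simp only [h, if_false]; exact h₂.isKnotFraming _ (ρ₂_mem t)
  continuousOn := by
    have hA : Continuous fun q : ℝ × (𝕊 1) =>
        (Bundle.TotalSpace.mk' E4 (Φ.toFun (ρ₁ q.1) q.2) (νt₁ (ρ₁ q.1) q.2) : TangentBundle (𝓡∂ 4) W) := by
      have hg : Continuous fun q : ℝ × (𝕊 1) => (ρ₁ q.1, q.2) :=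
        (contDiff_ρ₁.continuous.comp continuous_fst).prodMk continuous_snd
      have h := h₁.continuousOn.comp_continuous hg fun q => ⟨ρ₁_mem _, mem_univ _⟩
      exact h
    have hB : Continuous fun q : ℝ × (𝕊 1) =>
        (Bundle.TotalSpace.mk' E4 (Ψ.toFun (ρ₂ q.1) q.2) (νt₂ (ρ₂ q.1) q.2) : TangentBundle (𝓡∂ 4) W) := by
      have hg : Continuous fun q : ℝ × (𝕊 1) => (ρ₂ q.1, q.2) :=
        (contDiff_ρ₂.continuous.comp continuous_fst).prodMk continuous_snd
      have h := h₂.continuousOn.comp_continuous hg fun q => ⟨ρ₂_mem _, mem_univ _⟩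
      exact h
    have hif : Continuous fun q : ℝ × (𝕊 1) => if q.1 ≤ 1 / 2 then
        (Bundle.TotalSpace.mk' E4 (Φ.toFun (ρ₁ q.1) q.2) (νt₁ (ρ₁ q.1) q.2) : TangentBundle (𝓡∂ 4) W)
        else Bundle.TotalSpace.mk' E4 (Ψ.toFun (ρ₂ q.1) q.2) (νt₂ (ρ₂ q.1) q.2) := by
      refine Continuous.if_le hA hB continuous_fst continuous_const ?_
      rintro ⟨t, u⟩ (ht : t = 1 / 2)
      subst ht
      show (Bundle.TotalSpace.mk' E4 (Φ.toFun (ρ₁ (1 / 2)) u) (νt₁ (ρ₁ (1 / 2)) u) : TangentBundle (𝓡∂ 4) W) =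
        (Bundle.TotalSpace.mk' E4 (Ψ.toFun (ρ₂ (1 / 2)) u) (νt₂ (ρ₂ (1 / 2)) u) : TangentBundle (𝓡∂ 4) W)
      rw [ρ₁_of_ge (by norm_num), ρ₂_of_le (by norm_num), h₂.apply_zero, Φ.map_one, Ψ.map_zero]
    refine hif.continuousOn.congr ?_
    rintro ⟨t, u⟩ -
    show (Bundle.TotalSpace.mk' E4 ((Φ.trans' Ψ).toFun t u) ((if t ≤ 1 / 2 then νt₁ (ρ₁ t) else νt₂ (ρ₂ t)) u) :
      TangentBundle (𝓡∂ 4) W) = if (t, u).1 ≤ 1 / 2 then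
        (Bundle.TotalSpace.mk' E4 (Φ.toFun (ρ₁ (t, u).1) (t, u).2) (νt₁ (ρ₁ (t, u).1) (t, u).2) :
          TangentBundle (𝓡∂ 4) W)
        else Bundle.TotalSpace.mk' E4 (Ψ.toFun (ρ₂ (t, u).1) (t, u).2) (νt₂ (ρ₂ (t, u).1) (t, u).2)
    rw [trans'_toFun]
    by_cases h : t ≤ 1 / 2
    · simp only [h, if_true]
      rw [if_pos h]
    · simp only [h, if_false]
      rw [if_neg h]

end KnotIsotopyInBoundary

/-! ### Assembly: adding left twists -/

section Assembly

variable {W₀ : Type} [TopologicalSpace W₀] [T2Space W₀] [ChartedSpace (EuclideanHalfSpace 4) W₀]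
  [IsManifold (𝓡∂ 4) ∞ W₀] [CompactSpace W₀]

/-- **The twisting number of the phase-`0` end framing is that of the given framing** (TH).
[cite: Gompf1998, §1] -/
theorem LegendrianDarboux.StabData.twisting_νfam_half {S : SteinStructure W₀} (X : LegendrianDarboux.StabData S)
    {ν : 𝕊 1 → E4} (hν : IsKnotFraming X.K ν) :
    S.twisting X.K (X.νfam ν (1 / 2)) = S.twisting X.K ν :=
  (twisting_eq_of_framingHomotopic_holds W₀ S X.K ν (X.νfam ν (1 / 2)) X.legendrian
    (X.framingHomotopic_νfam_half hν)).symm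

/-- **Adding one left twist** (Gompf 1998, §1: "simply add a spiral"): a `C⁰`-small isotopy in
`∂W` to a Legendrian knot whose carried framing has twisting number one more. [cite: Gompf1998, §1] -/
theorem exists_addLeftTwist_one (S : SteinStructure W₀) {K : 𝕊 1 → W₀} {ν : 𝕊 1 → E4}
    (hK : IsLegendrianKnot S.J K) (hν : IsKnotFraming K ν) {𝒪 : Set ((𝕊 1) × W₀)} (h𝒪 : IsOpen 𝒪)
    (hK𝒪 : ∀ u, (u, K u) ∈ 𝒪) :
    ∃ (K' : 𝕊 1 → W₀) (Φ : KnotIsotopyInBoundary K K') (νt : ℝ → 𝕊 1 → E4),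
      IsLegendrianKnot S.J K' ∧ Φ.IsSmall 𝒪 ∧ IsFramingAlong Φ ν νt ∧
        S.twisting K' (νt 1) = S.twisting K ν + 1 := by
  obtain ⟨X, hXA, hsmall⟩ := (⟨K, hK, 0⟩ : LegendrianDarboux.LegendrianArc S).exists_stabData h𝒪 hK𝒪
  have hKX : X.K = K := congrArg LegendrianDarboux.LegendrianArc.K hXA
  have hsmall' : ∀ τ ∈ Icc (0 : ℝ) 1, ∀ t : ℝ, |t| ≤ 4 * X.ε →
      (circlePt (X.s₀ + t), X.bpt (LegendrianModel.scurve X.ε τ t)) ∈ 𝒪 := by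
    intro τ hτ t ht
    have h := hsmall τ hτ t ht
    show (circlePt (X.toLegendrianArc.s₀ + t), X.toLegendrianArc.bpt (LegendrianModel.scurve X.ε τ t)) ∈ 𝒪
    rw [hXA]
    exact h
  subst hKX
  refine ⟨X.knot 1, X.isotopy₂, X.νfam ν, X.isLegendrianKnot_knot_one, X.isSmall_isotopy₂ hK𝒪 hsmall',
    X.isFramingAlong_νfam hν, ?_⟩
  rw [X.twisting_knot_one hν, X.twisting_νfam_half hν]

/-- **Adding `n` left twists**, by induction (concatenating isotopies and framing families).
[cite: Gompf1998, §1] -/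
theorem exists_addLeftTwists (S : SteinStructure W₀) (n : ℕ) : ∀ {K : 𝕊 1 → W₀} {ν : 𝕊 1 → E4},
    IsLegendrianKnot S.J K → IsKnotFraming K ν → ∀ {𝒪 : Set ((𝕊 1) × W₀)}, IsOpen 𝒪 →
    (∀ u, (u, K u) ∈ 𝒪) →
    ∃ (K' : 𝕊 1 → W₀) (Φ : KnotIsotopyInBoundary K K') (νt : ℝ → 𝕊 1 → E4),
      IsLegendrianKnot S.J K' ∧ Φ.IsSmall 𝒪 ∧ IsFramingAlong Φ ν νt ∧
        S.twisting K' (νt 1) = S.twisting K ν + n := by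
  induction n with
  | zero =>
    intro K ν hK hν 𝒪 _ hK𝒪
    exact exists_knotIsotopyInBoundary_twisting_add_zero S hK hν hK𝒪
  | succ n ih =>
    intro K ν hK hν 𝒪 h𝒪 hK𝒪
    obtain ⟨K₁, Φ₁, νt₁, hK₁, hsm₁, hfr₁, htw₁⟩ := ih hK hν h𝒪 hK𝒪
    have hK₁𝒪 : ∀ u, (u, K₁ u) ∈ 𝒪 := fun u => by
      have := hsm₁ 1 ⟨zero_le_one, le_rfl⟩ u
      rwa [Φ₁.map_one] at this
    obtain ⟨K₂, Φ₂, νt₂, hK₂, hsm₂, hfr₂, htw₂⟩ :=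
      exists_addLeftTwist_one S hK₁ hfr₁.isKnotFraming_one h𝒪 hK₁𝒪
    refine ⟨K₂, Φ₁.trans' Φ₂, fun t => if t ≤ 1 / 2 then νt₁ (KnotIsotopyInBoundary.ρ₁ t)
      else νt₂ (KnotIsotopyInBoundary.ρ₂ t), hK₂, hsm₁.trans' hsm₂, hfr₁.trans' hfr₂, ?_⟩
    show S.twisting K₂ ((if (1 : ℝ) ≤ 1 / 2 then νt₁ (KnotIsotopyInBoundary.ρ₁ 1)
      else νt₂ (KnotIsotopyInBoundary.ρ₂ 1))) = _
    rw [if_neg (by norm_num), KnotIsotopyInBoundary.ρ₂_one, htw₂, htw₁]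
    push_cast
    ring

/-- **Discharge of the named fact `Gompf1998_addLeftTwists`** (Gompf 1998, §1, p. 622: "we can
add any number of left (negative) twists to a Legendrian link in a `C⁰`-small manner … simply
add a spiral"): by the explicit stabilisation in a Darboux box of a boundary chart
(`LegendrianStabilisationModel`, `LegendrianDarbouxBox`, `LegendrianDarbouxChart`), the box frame
transport of the framing, the model winding computation (`LegendrianStabilisationFraming`), the
homotopy invariance of the twisting number (TH) and induction on `n`. [cite: Gompf1998, §1] -/
theorem Gompf1998_addLeftTwists_holds : Gompf1998_addLeftTwists :=
  fun _ _ _ _ _ _ S _ _ n hK hν _ h𝒪 hK𝒪 => exists_addLeftTwists S n hK hν h𝒪 hK𝒪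

end Assembly

end Literature.Geometry.Symplectic

end
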